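import Mathlib
import HarnessLib
import Summits.AtomisticToContinuum.FouriersLaw.Theses.JunctionLocality
import Summits.AtomisticToContinuum.FouriersLaw.Theorems.JunctionLocalitySuperadditiveResistanceStubTerminationLocalityAux5
import Summits.AtomisticToContinuum.FouriersLaw.Theorems.JunctionLocalitySuperadditiveResistanceStubTerminationLocalityAux3
import Summits.AtomisticToContinuum.FouriersLaw.Theorems.JunctionLocalitySuperadditiveResistanceKuboPlain

/-!
# Termination locality in the κ-frame, helper VI: the mass term is `O(√κ)`, the block swap of resolvent families,
# and the reduction of S1' to ONE explicit `N`-uniform inequality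
(stub `stub_terminationLocality` (S1') of line `floating-probe-bypass-laplacian`, skeleton v7, crux
`JunctionLocality.SuperadditiveResistance`, stmt-AtomisticToContinuum-11748)

Helper V proved the exact κ-frame identity `K₀₀(κ) − G_N = −(γ²/T²)(S_N + Dyn_N(κ)) + (γ²/T²) κ X_N(κ)` with
`S_N = terminationStatic`, `Dyn_N = terminationDynamic`, `X_N = terminationMass`. Here:

* `resolventFamily_kubo` — for a resolvent family of the four terminals (the skeleton's `deviceResolventFields`) the
  Kubo matrix is symmetric PSD with `κ ‖g_a‖²_{L²(μ_T)} ≤ T²/γ` (the landed `kubo_onsager_resolvent`, skeleton vocabulary);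
* `mass_term_le` — hence the mass term is invisible eventually in `κ` at FIXED `N`: for every `G > 0`,
  `(γ²/T²) κ X_N(κ) ≤ G²` as soon as `κ ≤ T² G⁴ / (γ³ (‖g_N∘π_N‖² + 1))` (AM–GM, reversal invariance of `μ_T`);
* `comp_blockSwap_mem_deviceResolventFields`, `swapFamily_mem_resolvent` —
  resolvent families transport under the block swap `(N, M) ↔ (M, N)` of `…StubTerminationLocalityAux2/3`, and
  `K^{(M,N)}₀₀[g'] = K^{(N,M)}₃₃[g]`;
* `oneBlock_of_remainderBound` — **the ONE remaining `N`-uniform inequality**, written out as an explicit hypothesis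
  on a constant `C₁` (`∀ N, M ≥ 2 ∃ κ₁ > 0 ∀ κ ∈ (0, κ₁] ∀ resolvent families g ∀ plain forward fields g_N of the bare
  N-chain, −(γ²/T²)(S_N + Dyn_N(κ)) ≤ C₁ G_N²`; lead -0's termination remainder `S_N + Dyn_N` of `…TerminationIdentity`,
  with the κ-resolvent backward field in `Dyn_N`; no named object or proposition is introduced for it), gives the
  division-free one-block clause `K₀₀ − G_N ≤ C G_N K₀₀` eventually in `κ`
  (`C = max C₁ 0 + 1`; uniqueness of plain forward fields fixes the threshold, `K₀₀ ≥ 0` by PSD, `G_N > 0` by the landed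
  `plainKubo_pos`, and the case `K₀₀ < G_N` is free), and
* `stub_terminationLocality_of_oneBlockBound` (registered as `helper_terminationResolventReduction`, hypothesis written
  out) — **the registered stub `stub_terminationLocality` follows from `∃ C₁, <that inequality>`** (both blocks, by the
  block swap), every other ingredient proved.

So the `N`-uniform content of S1' is isolated as a one-sided bound on the concrete functional `S_N + Dyn_N(κ)`; nothing
`N`-uniform is claimed here (helper VII splits `Dyn_N` further, exactly, into the Rayleigh term `−(G_N/γ)(K₀₂ + K₀₃)` and
an end-site LTE deviation). Standard axioms; nothing taken as a named fact.
-/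

noncomputable section

open MeasureTheory Filter Topology
open scoped ContDiff
open Literature.MathematicalPhysics.KineticTheory.HeatConduction
open Summit.AtomisticToContinuum.FouriersLaw.Theorems.SuperadditiveResistance.DeviceLiouville
  (kin deviceGenerator deviceWeight deviceGenerator_eq kin_eq_sq liouvilleOp bathOp)
open Summit.AtomisticToContinuum.FouriersLaw.Theorems.SuperadditiveResistance.Kubo
  (rev rev_apply memLp_rev termWeight kubo_onsager_resolvent integral_rev_mul_gibbsDensity)
open Summit.AtomisticToContinuum.FouriersLaw.Theorems.SuperadditiveResistance.TerminationLocality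
  (restrictLeft memLp_comp_restrictLeft blockSwap kin_blockSwap deviceGenerator_comp_blockSwap_const
    memLp_comp_blockSwap pinnedChain_V_even swapFamily termSite_rev_add kuboMatrix_swapFamily_zero_zero)

namespace Summit.AtomisticToContinuum.FouriersLaw.Cruxes.SuperadditiveResistance.FloatingProbeBypassLaplacian

/-! ## Resolvent families: the Kubo–Onsager structure in the skeleton vocabulary -/

section Family

variable {ω₂ lam β γ T : ℝ} {N M : ℕ}

/-- **Kubo–Onsager structure of a resolvent family (skeleton vocabulary).** For `N, M ≥ 2`, `κ ≥ 0` and any family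
`g` with `g a ∈ deviceResolventFields … (termSite N M a) κ`: the Kubo matrix is symmetric, positive semidefinite,
and `κ ∫ g_a² dμ_T ≤ T²/γ` for every terminal (instance of the landed `kubo_onsager_resolvent`). -/
theorem resolventFamily_kubo (hω : 0 < ω₂) (hl : 0 ≤ lam) (hβ : 0 ≤ β) (hγ : 0 < γ) (hT : 0 < T)
    (hN : 2 ≤ N) (hM : 2 ≤ M) {κ : ℝ} (hκ : 0 ≤ κ) {g : Fin 4 → PhaseSpace (N + M) → ℝ}
    (hg : ∀ a : Fin 4, g a ∈ deviceResolventFields ω₂ lam β γ T N M (termSite N M a) κ) :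
    (kuboMatrix ω₂ lam β γ T N M g).IsSymm ∧
      (∀ θ : Fin 4 → ℝ, 0 ≤ ∑ a, ∑ b, θ a * kuboMatrix ω₂ lam β γ T N M g a b * θ b) ∧
      (∀ a, κ * ∫ x, g a x ^ 2 ∂((pinnedChain ω₂ lam β γ).gibbsMeasure (N + M) T) ≤ T ^ 2 / γ) := by
  have hN1 : 1 ≤ N := by omega
  have hM1 : 1 ≤ M := by omega
  set s := termFin N M hN1 hM1 with hs_def
  have hs : Function.Injective s := termFin_injective hN hM
  have hBw : deviceWeight N M = termWeight s := deviceWeight_eq_termWeight hN hM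
  have hg2 : ∀ b, ContDiff ℝ 2 (g b) := fun b => (hg b).1
  have hgL : ∀ b, MemLp (g b) 2 ((pinnedChain ω₂ lam β γ).gibbsMeasure (N + M) T) := fun b => (hg b).2.1
  have hkin : ∀ (b : Fin 4) (x : PhaseSpace (N + M)), kin (N + M) (termSite N M b) x = x.2 (s b) ^ 2 :=
    fun b x => kin_eq_sq (termSite_lt hN1 hM1 b) x
  have hpde : ∀ b x, (1 : ℝ) * liouvilleOp (pinnedChain ω₂ lam β γ) (N + M) (g b) x +
      γ * bathOp (N + M) (termWeight s) T (g b) x = -((x.2 (s b) ^ 2 - T) - κ * g b x) := by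
    intro b x
    have e := (hg b).2.2 x
    have hγP : (pinnedChain ω₂ lam β γ).γ = γ := rfl
    rw [hkin b x, deviceGenerator_eq, hBw, hγP] at e
    linarith
  have hK : ∀ b c, kuboMatrix ω₂ lam β γ T N M g b c = (if b = c then γ else 0) -
      γ ^ 2 / T ^ 2 * ∫ x, g b x * (x.2 (s c) ^ 2 - T) ∂((pinnedChain ω₂ lam β γ).gibbsMeasure (N + M) T) := by
    intro b c
    simp only [kuboMatrix, hkin c]
  obtain ⟨hsym, hpsd, -, hmass, -⟩ := kubo_onsager_resolvent hω hl hβ (N + M) hT s hs 1 hγ hκ hg2 hgL hpde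
    (kuboMatrix ω₂ lam β γ T N M g) hK
  exact ⟨hsym, hpsd, hmass⟩

end Family

/-! ## The mass term is `O(√κ)` at fixed `N` -/

section Mass

variable {ω₂ lam β γ T : ℝ} {N M : ℕ}

/-- AM–GM with a weight: `|a b| ≤ (ε a² + ε⁻¹ b²)/2` for `ε > 0`. -/
theorem abs_mul_le_weighted {ε : ℝ} (hε : 0 < ε) (a b : ℝ) : |a * b| ≤ (ε * a ^ 2 + ε⁻¹ * b ^ 2) / 2 := by
  rw [abs_mul, le_div_iff₀ (two_pos : (0 : ℝ) < 2)]
  have h := sq_nonneg (ε * |a| - |b|)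
  have key : |a| * |b| * 2 * ε ≤ (ε * a ^ 2 + ε⁻¹ * b ^ 2) * ε := by
    have e : (ε * a ^ 2 + ε⁻¹ * b ^ 2) * ε = (ε * |a|) ^ 2 + |b| ^ 2 := by
      rw [mul_pow, sq_abs, sq_abs]
      field_simp
    rw [e]
    nlinarith [h]
  exact le_of_mul_le_mul_right key hε

/-- `‖g∘R‖_{L²(μ_T)} = ‖g‖_{L²(μ_T)}`: the Gibbs state is invariant under momentum reversal. -/
theorem integral_rev_sq (P : OscillatorChain) (L : ℕ) (T : ℝ) (g : PhaseSpace L → ℝ) :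
    ∫ x, g (x.1, -x.2) ^ 2 ∂(P.gibbsMeasure L T) = ∫ x, g x ^ 2 ∂(P.gibbsMeasure L T) := by
  rw [P.integral_gibbsMeasure, P.integral_gibbsMeasure]
  congr 1
  exact integral_rev_mul_gibbsDensity P T (fun y => g y ^ 2)

/-- **The mass term, weighted AM–GM.** For `g_0 ∈ C² ∩ L²(μ_T^{(N+M)})`, `g_N ∈ L²(μ_T^{(N)})` and `ε > 0`:
`|X_N| ≤ (ε ‖g_0‖² + ε⁻¹ ‖g_N∘π_N‖²)/2` (norms in `L²(μ_T^{(N+M)})`). -/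
theorem abs_terminationMass_le (hω : 0 < ω₂) (hl : 0 ≤ lam) (hβ : 0 ≤ β) (hN : 1 ≤ N) (hM : 1 ≤ M) (hT : 0 < T)
    {g₀ : PhaseSpace (N + M) → ℝ} (hg₀C : ContDiff ℝ 2 g₀)
    (hg₀L : MemLp g₀ 2 ((pinnedChain ω₂ lam β γ).gibbsMeasure (N + M) T))
    {gN : PhaseSpace N → ℝ} (hgL2 : MemLp gN 2 ((pinnedChain ω₂ lam β γ).gibbsMeasure N T)) {ε : ℝ} (hε : 0 < ε) :
    |terminationMass ω₂ lam β γ T N M g₀ gN| ≤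
      (ε * ∫ x, g₀ x ^ 2 ∂((pinnedChain ω₂ lam β γ).gibbsMeasure (N + M) T) +
        ε⁻¹ * ∫ x, gN (x.1 ∘ Fin.castAdd M, x.2 ∘ Fin.castAdd M) ^ 2
          ∂((pinnedChain ω₂ lam β γ).gibbsMeasure (N + M) T)) / 2 := by
  set μ := (pinnedChain ω₂ lam β γ).gibbsMeasure (N + M) T with hμ
  have hrevL : MemLp (rev g₀) 2 μ := memLp_rev hω hl hβ (N + M) hT hg₀C.continuous hg₀L
  have hgNπL : MemLp (fun x : PhaseSpace (N + M) => gN (x.1 ∘ Fin.castAdd M, x.2 ∘ Fin.castAdd M)) 2 μ :=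
    memLp_comp_restrictLeft hω hl hβ γ hN hM hT hgL2
  have hI := integrable_terminationMass hω hl hβ hN hM hT hg₀C hg₀L hgL2 (γ := γ)
  have hA : Integrable (fun x : PhaseSpace (N + M) => g₀ (x.1, -x.2) ^ 2) μ := hrevL.integrable_sq
  have hB : Integrable (fun x : PhaseSpace (N + M) => gN (x.1 ∘ Fin.castAdd M, x.2 ∘ Fin.castAdd M) ^ 2) μ :=
    hgNπL.integrable_sq
  have hR : Integrable (fun x : PhaseSpace (N + M) =>
      (ε * g₀ (x.1, -x.2) ^ 2 + ε⁻¹ * gN (x.1 ∘ Fin.castAdd M, x.2 ∘ Fin.castAdd M) ^ 2) / 2) μ :=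
    ((hA.const_mul ε).add (hB.const_mul ε⁻¹)).div_const 2
  unfold terminationMass
  calc |∫ x, g₀ (x.1, -x.2) * gN (x.1 ∘ Fin.castAdd M, x.2 ∘ Fin.castAdd M) ∂μ|
      ≤ ∫ x, |g₀ (x.1, -x.2) * gN (x.1 ∘ Fin.castAdd M, x.2 ∘ Fin.castAdd M)| ∂μ := abs_integral_le_integral_abs
    _ ≤ ∫ x, (ε * g₀ (x.1, -x.2) ^ 2 + ε⁻¹ * gN (x.1 ∘ Fin.castAdd M, x.2 ∘ Fin.castAdd M) ^ 2) / 2 ∂μ :=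
        integral_mono hI.abs hR fun x => abs_mul_le_weighted hε _ _
    _ = (ε * ∫ x, g₀ x ^ 2 ∂μ + ε⁻¹ * ∫ x, gN (x.1 ∘ Fin.castAdd M, x.2 ∘ Fin.castAdd M) ^ 2 ∂μ) / 2 := by
        rw [integral_div, integral_add (hA.const_mul ε) (hB.const_mul ε⁻¹), integral_const_mul, integral_const_mul,
          integral_rev_sq]

/-- **The mass term is invisible eventually in `κ` (fixed `N`).** If `κ ‖g_0‖² ≤ T²/γ` (resolvent families,
`resolventFamily_kubo`) then for every `G > 0`: `(γ²/T²) κ X_N ≤ G²` as soon as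
`κ ≤ T² G⁴ / (γ³ (‖g_N∘π_N‖² + 1))`. -/
theorem mass_term_le (hω : 0 < ω₂) (hl : 0 ≤ lam) (hβ : 0 ≤ β) (hγ : 0 < γ) (hN : 1 ≤ N) (hM : 1 ≤ M)
    (hT : 0 < T) {κ : ℝ} (hκ : 0 ≤ κ) {g₀ : PhaseSpace (N + M) → ℝ} (hg₀C : ContDiff ℝ 2 g₀)
    (hg₀L : MemLp g₀ 2 ((pinnedChain ω₂ lam β γ).gibbsMeasure (N + M) T))
    (hκg : κ * ∫ x, g₀ x ^ 2 ∂((pinnedChain ω₂ lam β γ).gibbsMeasure (N + M) T) ≤ T ^ 2 / γ)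
    {gN : PhaseSpace N → ℝ} (hgL2 : MemLp gN 2 ((pinnedChain ω₂ lam β γ).gibbsMeasure N T)) {G : ℝ} (hG : 0 < G)
    (hκle : κ ≤ T ^ 2 * G ^ 4 / (γ ^ 3 *
      ((∫ x, gN (x.1 ∘ Fin.castAdd M, x.2 ∘ Fin.castAdd M) ^ 2 ∂((pinnedChain ω₂ lam β γ).gibbsMeasure (N + M) T)) + 1))) :
    γ ^ 2 / T ^ 2 * κ * terminationMass ω₂ lam β γ T N M g₀ gN ≤ G ^ 2 := by
  set A := ∫ x, g₀ x ^ 2 ∂((pinnedChain ω₂ lam β γ).gibbsMeasure (N + M) T) with hA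
  set B2 := ∫ x, gN (x.1 ∘ Fin.castAdd M, x.2 ∘ Fin.castAdd M) ^ 2
    ∂((pinnedChain ω₂ lam β γ).gibbsMeasure (N + M) T) with hB2
  set X := terminationMass ω₂ lam β γ T N M g₀ gN with hX
  have hB0 : 0 ≤ B2 := integral_nonneg fun x => sq_nonneg _
  have hε : 0 < G ^ 2 / γ := by positivity
  have h1 := abs_terminationMass_le hω hl hβ hN hM hT hg₀C hg₀L hgL2 hε (γ := γ)
  rw [← hX, ← hA, ← hB2] at h1
  -- `κ |X| ≤ (ε κ A + ε⁻¹ κ B2)/2 ≤ (G² T²/γ² + G² T²/γ²)/2`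
  have h2 : G ^ 2 / γ * (κ * A) ≤ G ^ 2 / γ * (T ^ 2 / γ) := mul_le_mul_of_nonneg_left hκg hε.le
  have h3 : κ * B2 ≤ T ^ 2 * G ^ 4 / γ ^ 3 := by
    have hB1 : 0 < B2 + 1 := by linarith
    calc κ * B2 ≤ κ * (B2 + 1) := by nlinarith
      _ ≤ T ^ 2 * G ^ 4 / (γ ^ 3 * (B2 + 1)) * (B2 + 1) := mul_le_mul_of_nonneg_right hκle hB1.le
      _ = T ^ 2 * G ^ 4 / γ ^ 3 := by field_simp
  have h4 : (G ^ 2 / γ)⁻¹ * (κ * B2) ≤ (G ^ 2 / γ)⁻¹ * (T ^ 2 * G ^ 4 / γ ^ 3) :=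
    mul_le_mul_of_nonneg_left h3 (inv_nonneg.mpr hε.le)
  have e4 : (G ^ 2 / γ)⁻¹ * (T ^ 2 * G ^ 4 / γ ^ 3) = G ^ 2 * T ^ 2 / γ ^ 2 := by
    field_simp
  have e2 : G ^ 2 / γ * (T ^ 2 / γ) = G ^ 2 * T ^ 2 / γ ^ 2 := by
    field_simp
  have hκX : κ * |X| ≤ G ^ 2 * T ^ 2 / γ ^ 2 := by
    have := mul_le_mul_of_nonneg_left h1 hκ
    calc κ * |X| ≤ κ * ((G ^ 2 / γ * A + (G ^ 2 / γ)⁻¹ * B2) / 2) := this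
      _ = (G ^ 2 / γ * (κ * A) + (G ^ 2 / γ)⁻¹ * (κ * B2)) / 2 := by ring
      _ ≤ (G ^ 2 * T ^ 2 / γ ^ 2 + G ^ 2 * T ^ 2 / γ ^ 2) / 2 := by linarith [h2, h4, e2, e4]
      _ = G ^ 2 * T ^ 2 / γ ^ 2 := by ring
  have hκX' : κ * X ≤ G ^ 2 * T ^ 2 / γ ^ 2 := (mul_le_mul_of_nonneg_left (le_abs_self X) hκ).trans hκX
  calc γ ^ 2 / T ^ 2 * κ * X = γ ^ 2 / T ^ 2 * (κ * X) := by ring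
    _ ≤ γ ^ 2 / T ^ 2 * (G ^ 2 * T ^ 2 / γ ^ 2) := mul_le_mul_of_nonneg_left hκX' (by positivity)
    _ = G ^ 2 := by field_simp

end Mass

/-! ## The block swap of resolvent families -/

section Swap

variable {ω₂ lam β γ T : ℝ} {N M : ℕ}

/-- **Resolvent fields transport under the block swap.** A `κ`-resolvent field of the `(N, M)`-device for the kinetic
observable of site `s` pulls back along `Φ_{M,N}` to a `κ`-resolvent field of the `(M, N)`-device for site
`s' = N+M−1−s` (`C²`, `L²(μ_T)` and the resolvent equation all transport; even interaction). -/
theorem comp_blockSwap_mem_deviceResolventFields (hN : 1 ≤ N) (hM : 1 ≤ M) {s s' : ℕ}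
    (hs : s + s' = N + M - 1) (hs' : s' < M + N) {κ : ℝ} {g : PhaseSpace (N + M) → ℝ}
    (hg : g ∈ deviceResolventFields ω₂ lam β γ T N M s κ) :
    g ∘ blockSwap M N ∈ deviceResolventFields ω₂ lam β γ T M N s' κ := by
  have hV := pinnedChain_V_even ω₂ lam β γ
  obtain ⟨hC, hL2, hpde⟩ := hg
  refine ⟨hC.comp (blockSwap M N).contDiff, memLp_comp_blockSwap _ hV T hL2, fun y => ?_⟩
  rw [deviceGenerator_comp_blockSwap_const _ hV hM hN T g y, Function.comp_apply, hpde,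
    kin_blockSwap (N := M) (M := N) (s := s') (s' := s) (by omega) hs' y]

/-- The swapped family of a resolvent family is a resolvent family of the swapped device (`N, M ≥ 1`). -/
theorem swapFamily_mem_resolvent (hN : 1 ≤ N) (hM : 1 ≤ M) {κ : ℝ} {g : Fin 4 → PhaseSpace (N + M) → ℝ}
    (hg : ∀ a : Fin 4, g a ∈ deviceResolventFields ω₂ lam β γ T N M (termSite N M a) κ) (c : Fin 4) :
    swapFamily N M g c ∈ deviceResolventFields ω₂ lam β γ T M N (termSite M N c) κ :=
  comp_blockSwap_mem_deviceResolventFields hN hM (termSite_rev_add hN hM c) (termSite_lt hM hN c) (hg (Fin.rev c))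

end Swap

/-! ## The one remaining `N`-uniform inequality and the reduction of the registered stub -/

section Reduction

variable {ω₂ lam β γ T : ℝ}

/-- **One block from the remainder bound.** The ONE remaining `N`-uniform inequality of S1' in the κ-frame, written
out as an explicit hypothesis on a constant `C₁` (for all splits `N, M ≥ 2`, eventually in `κ → 0⁺`, for every resolvent
family `g` and every plain forward field `g_N` of the bare `N`-chain: `−(γ²/T²)(S_N + Dyn_N(κ)) ≤ C₁ G_N²`, with
`S_N = terminationStatic`, `Dyn_N(κ) = terminationDynamic … (g 0) g_N`, `G_N = plainKubo … g_N`; nothing is claimed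
about it here), gives the division-free LEFT-block clause of S1', eventually in `κ`, with `C = max C₁ 0 + 1`: by the exact identity (helper V), `mass_term_le` at the threshold
fixed by THE plain forward field of the bare chain (landed existence `stub_plainForwardField` and uniqueness
`plainForwardField_unique'`), `K₀₀ ≥ 0` (PSD) and `G_N > 0` (landed `plainKubo_pos`); the case `K₀₀ < G_N` is free. -/
theorem oneBlock_of_remainderBound (hω : 0 < ω₂) (hl : 0 < lam) (hβ : 0 < β) (hγ : 0 < γ) (hT : 0 < T)
    {C₁ : ℝ}
    (hC₁ : ∀ (N M : ℕ) (hN : 2 ≤ N) (hM : 2 ≤ M), ∃ κ₁ : ℝ, 0 < κ₁ ∧ ∀ κ : ℝ, 0 < κ → κ ≤ κ₁ →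
      ∀ (g : Fin 4 → PhaseSpace (N + M) → ℝ) (gN : PhaseSpace N → ℝ),
        (∀ a : Fin 4, g a ∈ deviceResolventFields ω₂ lam β γ T N M (termSite N M a) κ) →
        gN ∈ plainForwardFields ω₂ lam β γ T N →
        -(γ ^ 2 / T ^ 2) * (terminationStatic ω₂ lam β γ T N M gN +
            terminationDynamic ω₂ lam β γ T (show 1 ≤ N by omega) (show 1 ≤ M by omega) (g 0) gN) ≤
          C₁ * plainKubo ω₂ lam β γ T N gN ^ 2) :
    ∃ C : ℝ, 0 ≤ C ∧ ∀ N M : ℕ, 2 ≤ N → 2 ≤ M → ∃ κ₁ : ℝ, 0 < κ₁ ∧ ∀ κ : ℝ, 0 < κ → κ ≤ κ₁ →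
      ∀ (g : Fin 4 → PhaseSpace (N + M) → ℝ) (gN : PhaseSpace N → ℝ),
        (∀ a : Fin 4, g a ∈ deviceResolventFields ω₂ lam β γ T N M (termSite N M a) κ) →
        gN ∈ plainForwardFields ω₂ lam β γ T N →
        kuboMatrix ω₂ lam β γ T N M g 0 0 - plainKubo ω₂ lam β γ T N gN ≤
          C * plainKubo ω₂ lam β γ T N gN * kuboMatrix ω₂ lam β γ T N M g 0 0 := by
  refine ⟨max C₁ 0 + 1, by positivity, fun N M hN hM => ?_⟩
  have hN1 : 1 ≤ N := by omega
  have hM1 : 1 ≤ M := by omega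
  obtain ⟨κh, hκh, hb⟩ := hC₁ N M hN hM
  -- THE plain forward field of the bare `N`-chain and the threshold it fixes
  obtain ⟨gS, hgS⟩ := stub_plainForwardField ω₂ lam β γ T hω hl hβ hγ hT N hN
  set G := plainKubo ω₂ lam β γ T N gS with hGdef
  have hG : 0 < G :=
    Theorems.SuperadditiveResistance.KuboPlain.plainKubo_pos ω₂ lam β γ T hω hl hβ hγ hT N hN gS hgS
  set B2 := ∫ x, gS (x.1 ∘ Fin.castAdd M, x.2 ∘ Fin.castAdd M) ^ 2
    ∂((pinnedChain ω₂ lam β γ).gibbsMeasure (N + M) T) with hB2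
  have hB0 : 0 ≤ B2 := integral_nonneg fun x => sq_nonneg _
  set κm : ℝ := T ^ 2 * G ^ 4 / (γ ^ 3 * (B2 + 1)) with hκm
  have hκm0 : 0 < κm := by positivity
  refine ⟨min κh κm, lt_min hκh hκm0, fun κ hκ hκle g gN hg hgN => ?_⟩
  -- uniqueness: `gN` is THE plain forward field
  have heq : gN = gS := plainForwardField_unique' hω hl.le hβ.le hγ (show 0 < N by omega) hT 0
    hgN.1 hgN.2.1 hgN.2.2.1 hgN.2.2.2 hgS.1 hgS.2.1 hgS.2.2.1 hgS.2.2.2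
  subst heq
  set K := kuboMatrix ω₂ lam β γ T N M g 0 0 with hK
  obtain ⟨-, hpsd, hmass⟩ := resolventFamily_kubo hω hl.le hβ.le hγ hT hN hM hκ.le hg
  have hK0 : 0 ≤ K := by
    have h0 := hpsd fun b => if b = 0 then 1 else 0
    have e : ∑ b : Fin 4, ∑ c : Fin 4, (if b = 0 then (1 : ℝ) else 0) * kuboMatrix ω₂ lam β γ T N M g b c *
        (if c = 0 then 1 else 0) = K := by
      simp [Finset.sum_ite_eq', ite_mul, mul_ite, hK]
    rw [e] at h0
    exact h0
  by_cases hKG : K < G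
  · have : 0 ≤ (max C₁ 0 + 1) * G * K := by positivity
    linarith
  · have hGK : G ≤ K := not_lt.mp hKG
    have hid := kuboMatrix_zero_zero_sub_plainKubo_resolvent hω hl.le hβ.le hγ hN1 hM1 hT κ g gN (hg 0) hgN
    have hbd := hb κ hκ (hκle.trans (min_le_left _ _)) g gN hg hgN
    have hmt := mass_term_le hω hl.le hβ.le hγ hN1 hM1 hT hκ.le (hg 0).1 (hg 0).2.1 (hmass 0) hgN.2.1 hG
      (hκle.trans (min_le_right _ _))
    have hC : C₁ * G ^ 2 ≤ max C₁ 0 * G ^ 2 := mul_le_mul_of_nonneg_right (le_max_left _ _) (sq_nonneg _)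
    have hGK' : G ^ 2 ≤ G * K := by nlinarith
    calc K - G = -(γ ^ 2 / T ^ 2) * (terminationStatic ω₂ lam β γ T N M gN +
          terminationDynamic ω₂ lam β γ T hN1 hM1 (g 0) gN) +
            γ ^ 2 / T ^ 2 * κ * terminationMass ω₂ lam β γ T N M (g 0) gN := hid
      _ ≤ max C₁ 0 * G ^ 2 + G ^ 2 := add_le_add (hbd.trans hC) hmt
      _ = (max C₁ 0 + 1) * G ^ 2 := by ring
      _ ≤ (max C₁ 0 + 1) * G * K := by
          rw [mul_assoc]
          exact mul_le_mul_of_nonneg_left hGK' (by positivity)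

/-- **THE REGISTERED STUB FROM THE ONE REMAINING INEQUALITY.** The existence of a constant `C₁` as in
`oneBlock_of_remainderBound` implies `stub_terminationLocality` at these parameters (skeleton v7 of line
`floating-probe-bypass-laplacian`): both blocks,
division-free, eventually in `κ` — the right block is the left block of the swapped split `(M, N)` (block swap of
resolvent families, `K^{(M,N)}₀₀[g'] = K₃₃[g]`), at the smaller of the two thresholds. -/
theorem stub_terminationLocality_of_oneBlockBound :
    ∀ ω₂ lam β γ T : ℝ, 0 < ω₂ → 0 < lam → 0 < β → 0 < γ → 0 < T →
      (∃ C₁ : ℝ, ∀ (N M : ℕ) (hN : 2 ≤ N) (hM : 2 ≤ M), ∃ κ₁ : ℝ, 0 < κ₁ ∧ ∀ κ : ℝ, 0 < κ → κ ≤ κ₁ →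
        ∀ (g : Fin 4 → PhaseSpace (N + M) → ℝ) (gN : PhaseSpace N → ℝ),
          (∀ a : Fin 4, g a ∈ deviceResolventFields ω₂ lam β γ T N M (termSite N M a) κ) →
          gN ∈ plainForwardFields ω₂ lam β γ T N →
          -(γ ^ 2 / T ^ 2) * (terminationStatic ω₂ lam β γ T N M gN +
              terminationDynamic ω₂ lam β γ T (show 1 ≤ N by omega) (show 1 ≤ M by omega) (g 0) gN) ≤
            C₁ * plainKubo ω₂ lam β γ T N gN ^ 2) →
      ∃ C₁ : ℝ, ∀ N M : ℕ, 2 ≤ N → 2 ≤ M → ∃ κ₁ : ℝ, 0 < κ₁ ∧ ∀ κ : ℝ, 0 < κ → κ ≤ κ₁ →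
        ∀ (g : Fin 4 → PhaseSpace (N + M) → ℝ) (gN : PhaseSpace N → ℝ) (gM : PhaseSpace M → ℝ),
          (∀ a : Fin 4, g a ∈ deviceResolventFields ω₂ lam β γ T N M (termSite N M a) κ) →
          gN ∈ plainForwardFields ω₂ lam β γ T N → gM ∈ plainForwardFields ω₂ lam β γ T M →
          kuboMatrix ω₂ lam β γ T N M g 0 0 - plainKubo ω₂ lam β γ T N gN ≤
              C₁ * plainKubo ω₂ lam β γ T N gN * kuboMatrix ω₂ lam β γ T N M g 0 0 ∧
            kuboMatrix ω₂ lam β γ T N M g 3 3 - plainKubo ω₂ lam β γ T M gM ≤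
              C₁ * plainKubo ω₂ lam β γ T M gM * kuboMatrix ω₂ lam β γ T N M g 3 3 := by
  intro ω₂ lam β γ T hω hl hβ hγ hT h
  obtain ⟨C₁, hC₁⟩ := h
  obtain ⟨C, -, hC⟩ := oneBlock_of_remainderBound hω hl hβ hγ hT hC₁
  refine ⟨C, fun N M hN hM => ?_⟩
  obtain ⟨κa, hκa, ha⟩ := hC N M hN hM
  obtain ⟨κb, hκb, hb⟩ := hC M N hM hN
  refine ⟨min κa κb, lt_min hκa hκb, fun κ hκ hκle g gN gM hg hgN hgM => ⟨?_, ?_⟩⟩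
  · exact ha κ hκ (hκle.trans (min_le_left _ _)) g gN hg hgN
  · have h' := hb κ hκ (hκle.trans (min_le_right _ _)) (swapFamily N M g) gM
      (swapFamily_mem_resolvent (by omega) (by omega) hg) hgM
    -- the landed block-swap identity of `…Aux3` (its vocabulary copies are definitionally the skeleton's)
    have e : kuboMatrix ω₂ lam β γ T M N (swapFamily N M g) 0 0 = kuboMatrix ω₂ lam β γ T N M g 3 3 :=
      kuboMatrix_swapFamily_zero_zero ω₂ lam β γ T (show 1 ≤ N by omega) (show 1 ≤ M by omega) g
    rwa [e] at h'

/-- Registered helper sub-goal `helper_terminationResolventReduction` (= `stub_terminationLocality_of_oneBlockBound` in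
stub form, the one remaining `N`-uniform inequality written out as an explicit hypothesis on a constant `C₁`). -/
theorem helper_terminationResolventReduction : ∀ (ω₂ lam β γ T : ℝ), 0 < ω₂ → 0 < lam → 0 < β → 0 < γ → 0 < T → ∀ (C₁ : ℝ), (∀ (N M : ℕ) (hN : 2 ≤ N) (hM : 2 ≤ M), ∃ κ₁ : ℝ, 0 < κ₁ ∧ ∀ κ : ℝ, 0 < κ → κ ≤ κ₁ → ∀ (g : Fin 4 → PhaseSpace (N + M) → ℝ) (gN : PhaseSpace N → ℝ), (∀ a : Fin 4, g a ∈ deviceResolventFields ω₂ lam β γ T N M (termSite N M a) κ) → gN ∈ plainForwardFields ω₂ lam β γ T N → -(γ ^ 2 / T ^ 2) * (((∫ x, gN (x.1 ∘ Fin.castAdd M, x.2 ∘ Fin.castAdd M) * (kin (N + M) 0 x - T) ∂((pinnedChain ω₂ lam β γ).gibbsMeasure (N + M) T)) - ∫ y, gN y * (kin N 0 y - T) ∂((pinnedChain ω₂ lam β γ).gibbsMeasure N T)) + ∫ x, g 0 (x.1, -x.2) * (((x.1 ⟨N, by omega⟩ - x.1 ⟨N - 1, by omega⟩) + β * (x.1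 ⟨N, by omega⟩ - x.1 ⟨N - 1, by omega⟩) ^ 3) * partialP ⟨N - 1, by omega⟩ gN (x.1 ∘ Fin.castAdd M, x.2 ∘ Fin.castAdd M)) ∂((pinnedChain ω₂ lam β γ).gibbsMeasure (N + M) T)) ≤ C₁ * plainKubo ω₂ lam β γ T N gN ^ 2) → ∃ C : ℝ, ∀ N M : ℕ, 2 ≤ N → 2 ≤ M → ∃ κ₁ : ℝ, 0 < κ₁ ∧ ∀ κ : ℝ, 0 < κ → κ ≤ κ₁ → ∀ (g : Fin 4 → PhaseSpace (N + M) → ℝ) (gN : PhaseSpace N → ℝ) (gM : PhaseSpace M → ℝ), (∀ a : Fin 4, g a ∈ deviceResolventFields ω₂ lam β γ T N M (termSite N M a) κ) → gN ∈ plainForwardFields ω₂ lam β γ T N → gM ∈ plainForwardFields ω₂ lam β γ T M → kuboMatrix ω₂ lam β γ T N M g 0 0 - plainKubo ω₂ lam β γ T N gN ≤ C * plainKubo ω₂ lam β γ T N gN * kuboMatrix ω₂ lam β γ T N M g 0 0 ∧ kuboMatrix ω₂ lam β γ T N M g 3 3 - plainKubo ω₂ lam β γ T M gM ≤ C * plainKubo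 ω₂ lam β γ T M gM * kuboMatrix ω₂ lam β γ T N M g 3 3 :=
  fun ω₂ lam β γ T hω hl hβ hγ hT C₁ h => stub_terminationLocality_of_oneBlockBound ω₂ lam β γ T hω hl hβ hγ hT ⟨C₁, h⟩

end Reduction

end Summit.AtomisticToContinuum.FouriersLaw.Cruxes.SuperadditiveResistance.FloatingProbeBypassLaplacian

end
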